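import Literature.NumberTheory.EllipticCurves.FormalGroupVariableChangeProofs
import Literature.NumberTheory.EllipticCurves.SigmaODELogDerivProofs
import Literature.NumberTheory.EllipticCurves.PadicSigmaUniquenessOrdinaryProofs
import Literature.NumberTheory.EllipticCurves.FormalGroupLogHomProofs
import Mathlib.Algebra.CharP.Invertible
import Mathlib.AlgebraicGeometry.EllipticCurve.NormalForms
import HarnessLib

/-!
# Transport of Mazur–Tate sigma pairs along an admissible change of variables (proofs only)

Trunk T-NT-EC (Literature/NumberTheory/EllipticCurves). Sequel of
`FormalGroupVariableChangeProofs.lean` (the isomorphism of formal groups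
`θ = formalVariableChange W vc`, `z' = θ(z)`, induced by `vc = (u, r, s, t)`, and the transport of
`w`, `x`, `[-1]`, `ω`, `D = d/ω` along it). Here we transport the Mazur–Tate sigma DATA of the
tree (`PadicSigma.lean`: `IsFormallyOdd`, `SatisfiesSigmaODE`, `IsMazurTateSigmaPair`):
if `(σ', c')` is a Mazur–Tate sigma pair of `W' = vc • W`, then

  `σ = u⁻¹ · σ' ∘ θ`,  `c = u² c' - r`

is a Mazur–Tate sigma pair of `W` — the sigma function is a function on the formal group, of
weight one in `ω` (`σ_{(E, λω)} = λ σ_{(E, ω)}`; here `ω_W = u⁻¹ ω_{W'}`), and the differential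
equation `x + c = -D(Dσ/σ)` transforms with `x = u²x' + r`, `D = u·D'`:

* `logDeriv₂Num_subst_formalVariableChange` — `N_W(h ∘ θ) = u²·(N_{W'} h) ∘ θ` for the
  pole-cleared second logarithmic derivative `N(f) = f·D²f - (Df)²`;
* `satisfiesSigmaODE_of_X_sq_mul_logDeriv₂Num`, `satisfiesSigmaODE_iff_X_sq_mul_logDeriv₂Num` —
  the converse of the tree's `X_sq_mul_logDeriv₂Num_of_satisfiesSigmaODE`
  (`SigmaODELogDerivProofs.lean`): for `σ = t + ⋯` the tree's encoding `SatisfiesSigmaODE W σ c`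
  (`ω·(t²x + ct²) = g - tg'`) is EQUIVALENT to `t²·N(σ) = -(t²x + ct²)·σ²`;
* `IsFormallyOdd.variableChange_subst` — oddness transports (`θ ∘ i = i' ∘ θ`);
* `SatisfiesSigmaODE.variableChange_subst` — the differential equation transports, with
  `c = u²c' - r`;
* `IsMazurTateSigmaPair.of_variableChange` — over `ℚ_p`, for a `p`-integral equation `W` and a
  `p`-integral change of variables with `u ∈ ℤ_pˣ`: **a Mazur–Tate sigma pair of `vc • W` yields
  one of `W`** (integrality of `θ ∈ ℤ_p⟦z⟧` and of `σ' ∘ θ`);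
  `exists_isMazurTateSigmaPair_of_variableChange` — hence existence transports;
* `formalLog_variableChange_subst` — `log' ∘ θ = u·log` (`θ` is an isomorphism of formal groups);
  `norm_coeff_formalOmega_variableChange_eq_one` — hence, comparing `z^p`-coefficients, the
  unit-ness of the Hasse coefficient `c_{p-1}` (`ω = Σ cₙzⁿdz`; `c_{p-1} ≡` Hasse invariant,
  Blakestad–Grant Prop. 3(b)) is invariant under `p`-integral changes with `u ∈ ℤ_pˣ`;
* `norm_toShortNF_le`, `isIntegral_toShortNF_smul` — for `p ≥ 5` Mathlib's explicit change
  `toShortNF = (1, -b₂/12, -a₁/2, ⋯)` to the short model `y² = x³ + a₄'x + a₆'` is `p`-integral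
  with `u = 1` (so `Δ' = Δ`), and the short model of a `p`-integral equation is `p`-integral;
* `norm_Δ_baseChange_eq_one_of_hasGoodReductionAtPrime` — good reduction of a globally minimal
  `W` at `p` gives `‖Δ_W‖_p = 1` (AEC VII.1.3(b), VII.5.1(a); a public copy of a private lemma of
  `PadicSigmaUniquenessOrdinaryProofs.lean`);
* `mazur_tate_sigma_existsUnique_of_exists_shortModel` — **the tree's named fact
  `mazur_tate_sigma_existsUnique` (Mazur–Stein–Tate 2006, Thm. 1.3) follows from the EXISTENCE of
  a Mazur–Tate sigma pair for the SHORT Weierstrass model `(W ⊗ ℚ_p).toShortNF • (W ⊗ ℚ_p)`** of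
  a globally minimal `W/ℚ` at every prime `p ≥ 5` of good ordinary reduction — the setting of
  Blakestad–Grant 2023 (Thm. 1, Thm. 15: `y² = x³ + a₄x + a₆` over a `p`-complete ring, `p > 3`)
  and of Mazur–Tate 1991 — the uniqueness half being the tree's
  `mazur_tate_sigma_existsUnique_of_exists` (`PadicSigmaUniquenessOrdinaryProofs.lean`).

## Sources

* B. Mazur, J. Tate, *The `p`-adic sigma function*, Duke Math. J. 62 (1991), §3, Thm. 3.1
  (`σ` attached to `(E, ω)` over a `p`-adic ring; behaviour under `ω ↦ λω`). [MazurTate1991]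
* B. Mazur, W. Stein, J. Tate, Doc. Math. Extra Vol. Coates (2006), Thm. 1.3 (the pair
  `(σ, c)`, `x(t) + c = -(d/ω)(σ⁻¹dσ/ω)`), §1 eq. for `c` (`c = (a₁² + 4a₂)/12 - E₂(E,ω)/12`,
  weight 2). [MazurSteinTate2006]
* C. Blakestad, D. Grant, J. Number Theory 249 (2023) (arXiv:1903.02480), §2 (weights
  `x, y, t, ω ↦ 2, 3, -1, -1`), Thm. 1, §3 and Thm. 15 (the model `y² = x³ + a₄x + a₆`, `p > 3`).
  [BlakestadGrant2023]
* J. H. Silverman, *AEC* 2nd ed. (2009), III.1 (Table 3.1: `u⁻¹ω' = ω`, `x = u²x' + r`), IV.1,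
  VII.2 (integrality). [SilvermanAEC2009]

## Design notes

Pure proof file: no definitions, no named facts. The transport is first done over an arbitrary
commutative (`ℚ`-)algebra; `p`-adic integrality enters only in `IsMazurTateSigmaPair`. The glue
`mazur_tate_sigma_existsUnique_of_exists_shortModel` does NOT prove existence (Mazur–Tate 1991 /
Blakestad–Grant 2023 Thm. 1, the deep half, is not in the tree); it only moves the burden to the
short model.
-/

noncomputable section

open PowerSeries Literature.NumberTheory.EllipticCurves

namespace WeierstrassCurve

/-! ### Over a commutative ring: `N`, oddness -/

section Ring

variable {R : Type*} [CommRing R] (W : WeierstrassCurve R) (vc : VariableChange R)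

/-- **`N_W(h ∘ θ) = u²·(N_{W'} h) ∘ θ`** for `N(f) = f·D(Df) - (Df)²` (`logDeriv₂Num`) and the
invariant derivations `D = d/ω_W`, `D' = d/ω_{vc • W}`: from the chain rule `D(h ∘ θ) = u·(D'h) ∘ θ`.
[Blakestad–Grant 2023, §2 (weights of `D`)] [folklore] -/
theorem logDeriv₂Num_subst_formalVariableChange (h : R⟦X⟧) :
    logDeriv₂Num W.formalInvariantDerivation (h.subst (W.formalVariableChange vc)) =
      C (vc.u : R) ^ 2 *
        (logDeriv₂Num (vc • W).formalInvariantDerivation h).subst (W.formalVariableChange vc) := by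
  have hθs := W.hasSubst_formalVariableChange vc
  rw [logDeriv₂Num_def, logDeriv₂Num_def,
    W.formalInvariantDerivation_formalInvariantDerivation_subst_formalVariableChange vc h,
    W.formalInvariantDerivation_subst_formalVariableChange vc h, subst_sub hθs, subst_mul hθs,
    subst_pow hθs]
  ring

variable {W vc} in
/-- **Oddness transports**: if `σ'` is odd for `vc • W` (`σ'(i'(z')) = -σ'(z')`), then
`κ·σ' ∘ θ` is odd for `W`, because `θ(i(z)) = i'(θ(z))` (`formalNeg_variableChange_subst`).
[Mazur–Tate 1991, §3; Harvey 2008, §4 (oddness `σ(i(t)) = -σ(t)`)] [folklore] -/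
theorem IsFormallyOdd.variableChange_subst {σ' : R⟦X⟧} (hodd : (vc • W).IsFormallyOdd σ') (κ : R) :
    W.IsFormallyOdd (C κ * σ'.subst (W.formalVariableChange vc)) := by
  have hθs := W.hasSubst_formalVariableChange vc
  have his := W.hasSubst_formalNeg
  have his' := (vc • W).hasSubst_formalNeg
  unfold IsFormallyOdd at hodd ⊢
  rw [subst_mul his, subst_C, subst_comp_subst_apply hθs his,
    ← W.formalNeg_variableChange_subst vc, ← subst_comp_subst_apply his' hθs, hodd,
    ← coe_substAlgHom hθs, map_neg, mul_neg]
  rfl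

/-- `(σ' ∘ θ)(0) = 0` for `σ'(0) = 0`. [folklore] -/
theorem constantCoeff_subst_formalVariableChange {σ' : R⟦X⟧} (hσ0 : constantCoeff σ' = 0) :
    constantCoeff (σ'.subst (W.formalVariableChange vc)) = 0 :=
  MvPowerSeries.constantCoeff_subst_eq_zero
    (PowerSeries.HasSubst.const (W.hasSubst_formalVariableChange vc))
    (fun _ => W.constantCoeff_formalVariableChange vc) hσ0

/-- `[z¹](σ' ∘ θ) = u` for `σ' = z' + ⋯` (`θ = uz + ⋯`). [folklore] -/
theorem coeff_one_subst_formalVariableChange {σ' : R⟦X⟧} (hσ1 : coeff 1 σ' = 1) :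
    coeff 1 (σ'.subst (W.formalVariableChange vc)) = vc.u := by
  rw [coeff_subst_eq_sum_range (W.constantCoeff_formalVariableChange vc), Finset.sum_range_succ,
    Finset.sum_range_succ, Finset.sum_range_zero, zero_add, pow_zero, pow_one, coeff_one,
    if_neg one_ne_zero, zero_mul, zero_add, W.coeff_one_formalVariableChange vc, hσ1, mul_one]

end Ring

/-! ### Over a `ℚ`-algebra: the differential equation -/

section ODE

variable {A : Type*} [CommRing A] [Algebra ℚ A] (V : WeierstrassCurve A) (vc : VariableChange A)

variable {V} in
/-- **The converse encoding**: if `σ = t + ⋯` satisfies `t²·(σ·D(Dσ) - (Dσ)²) = -(t²x + ct²)·σ²`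
(`D = d/ω`), then it satisfies the tree's pole-cleared sigma equation `SatisfiesSigmaODE W σ c`
(`ω·(t²x + ct²) = g - tg'`, `g = (s + ts')(ωs)⁻¹ = t·Dσ/σ`, `s = σ/t`). With
`X_sq_mul_logDeriv₂Num_of_satisfiesSigmaODE` (`SigmaODELogDerivProofs.lean`) the two encodings
of `x(t) + c = -(d/ω)(σ⁻¹ dσ/ω)` are equivalent. Proof: for every normalised `σ` one has
`t²·N(σ) = t²·η·s²·(tg' - g)` (`Dσ = gs`, `D²σ = η(gs' + sg')`, `gs = η(s + ts')`); cancel `t²`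
and the unit `s²`, multiply by `ω = η⁻¹`. [Mazur–Stein–Tate 2006, Thm. 1.3; Blakestad–Grant 2023,
Thm. 1] [folklore] -/
theorem satisfiesSigmaODE_of_X_sq_mul_logDeriv₂Num {σ : A⟦X⟧} {c : A}
    (hσ0 : constantCoeff σ = 0) (hσ1 : coeff 1 σ = 1)
    (h : X ^ 2 * logDeriv₂Num V.formalInvariantDerivation σ =
      -(V.formalXMulSq + C c * X ^ 2) * σ ^ 2) :
    V.SatisfiesSigmaODE σ c := by
  show V.formalOmega * (V.formalXMulSq + C c * X ^ 2) =
      ((PowerSeries.mk fun n => coeff (n + 1) σ) + X * d⁄dX A (PowerSeries.mk fun n => coeff (n + 1) σ)) *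
          PowerSeries.invOfUnit (V.formalOmega * PowerSeries.mk fun n => coeff (n + 1) σ) 1 -
        X * d⁄dX A (((PowerSeries.mk fun n => coeff (n + 1) σ) +
          X * d⁄dX A (PowerSeries.mk fun n => coeff (n + 1) σ)) *
          PowerSeries.invOfUnit (V.formalOmega * PowerSeries.mk fun n => coeff (n + 1) σ) 1)
  set s : A⟦X⟧ := PowerSeries.mk fun n => coeff (n + 1) σ with hs
  set ui := PowerSeries.invOfUnit (V.formalOmega * s) 1 with hui
  set g := (s + X * d⁄dX A s) * ui with hg
  -- `σ = t·s`, `s(0) = 1`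
  have hσ : σ = X * s := by
    ext n
    cases n with
    | zero => rw [coeff_zero_X_mul, coeff_zero_eq_constantCoeff_apply, hσ0]
    | succ n => rw [coeff_succ_X_mul, hs, coeff_mk]
  have hs0 : constantCoeff s = 1 := by
    rw [← coeff_zero_eq_constantCoeff_apply, hs, coeff_mk]
    exact hσ1
  have hsU : IsUnit (s ^ 2) := by
    refine IsUnit.pow 2 ?_
    rw [PowerSeries.isUnit_iff_constantCoeff, hs0]; exact isUnit_one
  -- `ωη = 1`, `(ωs)·(ωs)⁻¹ = 1`
  have hωη : V.formalOmega * V.formalEta = 1 := V.formalOmega_mul_formalEta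
  have hu : V.formalOmega * s * ui = 1 :=
    PowerSeries.mul_invOfUnit (V.formalOmega * s) 1
      (by rw [map_mul, V.constantCoeff_formalOmega, hs0, mul_one, Units.val_one])
  -- `g·s = η(s + ts') = Dσ`, `D²σ = η(gs' + sg')`
  have hgs : g * s = V.formalEta * (s + X * d⁄dX A s) := by
    linear_combination s * hg + (-(s + X * d⁄dX A s) * ui * s) * hωη +
      ((s + X * d⁄dX A s) * V.formalEta) * hu
  have hDσ : V.formalInvariantDerivation σ = g * s := by
    rw [hgs, formalInvariantDerivation_apply, hσ, Derivation.leibniz, derivative_X, smul_eq_mul,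
      smul_eq_mul]
    ring
  have hDDσ : V.formalInvariantDerivation (V.formalInvariantDerivation σ) =
      V.formalEta * (g * d⁄dX A s + s * d⁄dX A g) := by
    rw [hDσ, formalInvariantDerivation_apply, Derivation.leibniz, smul_eq_mul, smul_eq_mul]
  -- the hypothesis, as `t²·η·s²·(tg' - g) = -(X + ct²)·t²·s²`
  rw [logDeriv₂Num, hDDσ, hDσ, hσ] at h
  have key : X ^ 2 * (V.formalEta * (X * d⁄dX A g - g) * s ^ 2) =
      X ^ 2 * (-(V.formalXMulSq + C c * X ^ 2) * s ^ 2) := by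
    linear_combination h + (X ^ 2 * g * s) * hgs
  have key3 : V.formalEta * (X * d⁄dX A g - g) = -(V.formalXMulSq + C c * X ^ 2) :=
    hsU.mul_right_cancel (PowerSeries.X_pow_mul_cancel key)
  linear_combination V.formalOmega * key3 - (X * d⁄dX A g - g) * hωη

variable {V} in
/-- **The two encodings of the sigma equation are equivalent** for `σ = t + ⋯`:
`SatisfiesSigmaODE W σ c ↔ t²·(σ·D²σ - (Dσ)²) = -(t²x + ct²)·σ²`.
[Mazur–Stein–Tate 2006, Thm. 1.3] [folklore] -/
theorem satisfiesSigmaODE_iff_X_sq_mul_logDeriv₂Num {σ : A⟦X⟧} {c : A}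
    (hσ0 : constantCoeff σ = 0) (hσ1 : coeff 1 σ = 1) :
    V.SatisfiesSigmaODE σ c ↔
      X ^ 2 * logDeriv₂Num V.formalInvariantDerivation σ =
        -(V.formalXMulSq + C c * X ^ 2) * σ ^ 2 :=
  ⟨X_sq_mul_logDeriv₂Num_of_satisfiesSigmaODE hσ0 hσ1,
    satisfiesSigmaODE_of_X_sq_mul_logDeriv₂Num hσ0 hσ1⟩

variable {V vc} in
/-- **The sigma differential equation transports along a change of variables.** If
`σ' = z' + ⋯` satisfies `x' + c' = -D'(D'σ'/σ')` for `vc • W` (`D' = d/ω'`), then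
`σ = u⁻¹·σ' ∘ θ` satisfies `x + c = -D(Dσ/σ)` for `W` with **`c = u²c' - r`**: indeed
`x' ∘ θ = u⁻²(x - r)`, `D = u·D'` (`ω' = uω`) and `D(D log(λ f)) = D(D log f)`. (This is the
weight-2 behaviour of `c = (a₁² + 4a₂)/12 - E₂/12`, MST 2006 §1.)
[Mazur–Tate 1991, §3; Mazur–Stein–Tate 2006, Thm. 1.3 and §1; Blakestad–Grant 2023, §2 (weights)]
[cite: MazurSteinTate2006, Thm. 1.3] -/
theorem SatisfiesSigmaODE.variableChange_subst {σ' : A⟦X⟧} {c' : A}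
    (hσ0 : constantCoeff σ' = 0) (hσ1 : coeff 1 σ' = 1) (hODE : (vc • V).SatisfiesSigmaODE σ' c') :
    V.SatisfiesSigmaODE (C ((vc.u⁻¹ : Aˣ) : A) * σ'.subst (V.formalVariableChange vc))
      ((vc.u : A) ^ 2 * c' - vc.r) := by
  have hθs := V.hasSubst_formalVariableChange vc
  have hθ0 := V.constantCoeff_formalVariableChange vc
  have hS0 := V.constantCoeff_subst_formalVariableChange vc hσ0
  have hS1 := V.coeff_one_subst_formalVariableChange vc hσ1
  have hu := C_u_mul_C_u_inv vc
  -- the `N`-form for `σ'`, pulled back along `θ`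
  have hN' := X_sq_mul_logDeriv₂Num_of_satisfiesSigmaODE hσ0 hσ1 hODE
  have h1 : ((X : A⟦X⟧) ^ 2 * logDeriv₂Num (vc • V).formalInvariantDerivation σ').subst
      (V.formalVariableChange vc) =
      (-((vc • V).formalXMulSq + C c' * X ^ 2) * σ' ^ 2).subst (V.formalVariableChange vc) := by
    rw [hN']
  have hCθ : ∀ a : A, (C a).subst (V.formalVariableChange vc) = C a := fun a => PowerSeries.subst_C a
  simp only [← coe_substAlgHom hθs, map_mul, map_pow, map_neg, map_add, substAlgHom_X] at h1
  simp only [coe_substAlgHom hθs, hCθ] at h1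
  have hB1 := V.logDeriv₂Num_subst_formalVariableChange vc σ'
  have hA3 := V.formalXMulSq_variableChange_subst_mul_X_sq vc
  refine satisfiesSigmaODE_of_X_sq_mul_logDeriv₂Num ?_ ?_ ?_
  · rw [map_mul, hS0, mul_zero]
  · rw [coeff_C_mul, hS1, Units.inv_mul]
  · rw [logDeriv₂Num_const_mul _ (V.formalInvariantDerivation_C _), map_sub, map_mul, map_pow]
    -- `θ² · (goal) = 0`, then cancel `θ² = z²·φ²` with `φ(0) = u` a unit
    have key : V.formalVariableChange vc ^ 2 *
        (X ^ 2 * logDeriv₂Num V.formalInvariantDerivation (σ'.subst (V.formalVariableChange vc)) +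
          (V.formalXMulSq + (C (vc.u : A) ^ 2 * C c' - C vc.r) * X ^ 2) *
            σ'.subst (V.formalVariableChange vc) ^ 2) = 0 := by
      set θ := V.formalVariableChange vc with hθdef
      set S := σ'.subst (V.formalVariableChange vc) with hSdef
      set Nθ := (logDeriv₂Num (vc • V).formalInvariantDerivation σ').subst (V.formalVariableChange vc)
        with hNθ
      set NV := logDeriv₂Num V.formalInvariantDerivation S with hNV
      set T := (vc • V).formalXMulSq.subst (V.formalVariableChange vc) with hT
      set u : A⟦X⟧ := C (vc.u : A) with hudef
      set ui : A⟦X⟧ := C ((vc.u⁻¹ : Aˣ) : A) with huidef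
      linear_combination (X ^ 2 * u ^ 2) * h1 + (θ ^ 2 * X ^ 2) * hB1 - (u ^ 2 * S ^ 2) * hA3 -
        (θ ^ 2 * S ^ 2 * (V.formalXMulSq - C vc.r * X ^ 2) * (u * ui + 1)) * hu
    have hθφ : V.formalVariableChange vc = X * sigmaShift (V.formalVariableChange vc) :=
      (X_mul_sigmaShift hθ0).symm
    have hφU : IsUnit (sigmaShift (V.formalVariableChange vc) ^ 2) := by
      refine IsUnit.pow 2 ?_
      rw [PowerSeries.isUnit_iff_constantCoeff, constantCoeff_sigmaShift,
        V.coeff_one_formalVariableChange vc]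
      exact Units.isUnit vc.u
    have key2 : sigmaShift (V.formalVariableChange vc) ^ 2 *
        (X ^ 2 * logDeriv₂Num V.formalInvariantDerivation (σ'.subst (V.formalVariableChange vc)) +
          (V.formalXMulSq + (C (vc.u : A) ^ 2 * C c' - C vc.r) * X ^ 2) *
            σ'.subst (V.formalVariableChange vc) ^ 2) = 0 := by
      refine PowerSeries.X_pow_mul_cancel (k := 2) ?_
      rw [mul_zero, ← mul_assoc, ← mul_pow, ← hθφ]
      exact key
    have key3 := (hφU.mul_right_eq_zero).mp key2
    linear_combination (C ((vc.u⁻¹ : Aˣ) : A)) ^ 2 * key3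

end ODE


/-! ### The formal logarithm under `θ`; `[zⁿ]θⁿ = uⁿ` -/

section Log

variable {R : Type*} [CommRing R] (W : WeierstrassCurve R) (vc : VariableChange R)

/-- `[zⁿ] θ(z)ⁿ = uⁿ` (`θ = uz + ⋯`). [folklore] -/
theorem coeff_self_pow_formalVariableChange (n : ℕ) :
    coeff n (W.formalVariableChange vc ^ n) = (vc.u : R) ^ n := by
  have hθ : W.formalVariableChange vc = X * sigmaShift (W.formalVariableChange vc) :=
    (X_mul_sigmaShift (W.constantCoeff_formalVariableChange vc)).symm
  rw [hθ, mul_pow, coeff_X_pow_mul', if_pos le_rfl, Nat.sub_self, coeff_zero_eq_constantCoeff_apply,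
    map_pow, constantCoeff_sigmaShift, W.coeff_one_formalVariableChange vc]

/-- `[zᵐ] θ(z)ⁿ = 0` for `m < n`. [folklore] -/
theorem coeff_pow_formalVariableChange_of_lt {m n : ℕ} (h : m < n) :
    coeff m (W.formalVariableChange vc ^ n) = 0 := by
  have hθ : W.formalVariableChange vc = X * sigmaShift (W.formalVariableChange vc) :=
    (X_mul_sigmaShift (W.constantCoeff_formalVariableChange vc)).symm
  rw [hθ, mul_pow, coeff_X_pow_mul', if_neg (not_le.mpr h)]

variable {A : Type*} [CommRing A] [Algebra ℚ A] [IsAddTorsionFree A]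
  (V : WeierstrassCurve A) (vc' : VariableChange A)

/-- **`log' ∘ θ = u·log`**: the isomorphism `θ : Ŵ ⥲ (vc • W)^` intertwines the formal logarithms
up to the factor `u = θ'(0)` — both sides vanish at `0` and have derivative `u·ω`
(`ω'(θ)·θ' = u·ω`, `log' = ∫ω'`, `log = ∫ω`). [Silverman AEC IV.5 (formal logarithm), III.1
(Table 3.1)] [cite: SilvermanAEC2009, IV.5.5] -/
theorem formalLog_variableChange_subst :
    (vc' • V).formalLog.subst (V.formalVariableChange vc') = C (vc'.u : A) * V.formalLog := by
  have hθs := V.hasSubst_formalVariableChange vc'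
  refine PowerSeries.derivative.ext ?_ ?_
  · rw [PowerSeries.derivative_subst A hθs, (vc' • V).derivative_formalLog, Derivation.leibniz,
      derivative_C, smul_zero, add_zero, smul_eq_mul, V.derivative_formalLog,
      V.formalOmega_variableChange_subst_mul_derivative vc']
  · rw [map_mul, V.constantCoeff_formalLog, mul_zero]
    exact MvPowerSeries.constantCoeff_subst_eq_zero (PowerSeries.HasSubst.const hθs)
      (fun _ => V.constantCoeff_formalVariableChange vc') (vc' • V).constantCoeff_formalLog

end Log

/-! ### Over `ℚ_p`: integrality and the transport of Mazur–Tate pairs -/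

section Padic

variable {p : ℕ} [Fact p.Prime] (V : WeierstrassCurve ℚ_[p]) (vc : VariableChange ℚ_[p])

/-- A natural number `0 < n < p` is a `p`-adic unit: `‖(n : ℚ_p)⁻¹‖ = 1` (so `2⁻¹, 3⁻¹, 12⁻¹ ∈ ℤ_p`
for `p ≥ 5`, …). [folklore] -/
theorem norm_inv_natCast_eq_one {n : ℕ} (hn : 0 < n) (hnp : n < p) : ‖(n : ℚ_[p])⁻¹‖ = 1 := by
  have h : ‖(n : ℚ_[p])‖ = 1 := by
    rw [Padic.norm_natCast_eq_one_iff]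
    exact (Nat.Prime.coprime_iff_not_dvd Fact.out).mpr (Nat.not_dvd_of_pos_of_lt hn hnp)
  rw [norm_inv, h, inv_one]

/-- `⅟n ∈ ℤ_p` for `0 < n < p`. [folklore] -/
theorem invOf_natCast_mem_subring (n : ℕ) [Invertible (n : ℚ_[p])] (hn : 0 < n) (hnp : n < p) :
    (⅟(n : ℚ_[p])) ∈ PadicInt.subring p := by
  rw [PadicInt.mem_subring_iff, invOf_eq_inv, norm_inv_natCast_eq_one hn hnp]

/-- The coefficients of a `p`-integral equation lie in `ℤ_p ⊆ ℚ_p`. [folklore] -/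
theorem coeffs_mem_subring [V.IsIntegral ℤ_[p]] :
    V.a₁ ∈ PadicInt.subring p ∧ V.a₂ ∈ PadicInt.subring p ∧ V.a₃ ∈ PadicInt.subring p ∧
      V.a₄ ∈ PadicInt.subring p ∧ V.a₆ ∈ PadicInt.subring p := by
  simp only [PadicInt.mem_subring_iff]
  exact V.norm_coeffs_le_one

/-- An equation with coefficients in `ℤ_p ⊆ ℚ_p` is `p`-integral. [folklore] -/
theorem isIntegral_of_mem_subring (V' : WeierstrassCurve ℚ_[p]) (h₁ : V'.a₁ ∈ PadicInt.subring p)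
    (h₂ : V'.a₂ ∈ PadicInt.subring p) (h₃ : V'.a₃ ∈ PadicInt.subring p)
    (h₄ : V'.a₄ ∈ PadicInt.subring p) (h₆ : V'.a₆ ∈ PadicInt.subring p) : V'.IsIntegral ℤ_[p] :=
  isIntegral_of_exists_lift ℤ_[p] ⟨⟨V'.a₁, h₁⟩, rfl⟩ ⟨⟨V'.a₂, h₂⟩, rfl⟩ ⟨⟨V'.a₃, h₃⟩, rfl⟩
    ⟨⟨V'.a₄, h₄⟩, rfl⟩ ⟨⟨V'.a₆, h₆⟩, rfl⟩

/-- **A `p`-integral change of variables with `u ∈ ℤ_pˣ` preserves `p`-integrality** (the `aᵢ'`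
are polynomials in the `aᵢ`, `r, s, t` and `u⁻¹`, AEC III.1 Table 3.1). [Silverman AEC III.1,
VII.1] [folklore] -/
theorem isIntegral_variableChange [V.IsIntegral ℤ_[p]] (hu : ‖(vc.u : ℚ_[p])‖ = 1)
    (hr : ‖vc.r‖ ≤ 1) (hs : ‖vc.s‖ ≤ 1) (ht : ‖vc.t‖ ≤ 1) : (vc • V).IsIntegral ℤ_[p] := by
  obtain ⟨h₁, h₂, h₃, h₄, h₆⟩ := V.coeffs_mem_subring
  have hui : ((vc.u⁻¹ : ℚ_[p]ˣ) : ℚ_[p]) ∈ PadicInt.subring p := by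
    rw [PadicInt.mem_subring_iff, Units.val_inv_eq_inv_val, norm_inv, hu, inv_one]
  rw [← PadicInt.mem_subring_iff] at hr hs ht
  refine isIntegral_of_mem_subring _ ?_ ?_ ?_ ?_ ?_
  · rw [variableChange_a₁]
    exact mul_mem hui (add_mem h₁ (mul_mem (ofNat_mem _ _) hs))
  · rw [variableChange_a₂]
    exact mul_mem (pow_mem hui _) (sub_mem (add_mem (sub_mem h₂ (mul_mem hs h₁))
      (mul_mem (ofNat_mem _ _) hr)) (pow_mem hs _))
  · rw [variableChange_a₃]
    exact mul_mem (pow_mem hui _) (add_mem (add_mem h₃ (mul_mem hr h₁)) (mul_mem (ofNat_mem _ _) ht))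
  · rw [variableChange_a₄]
    exact mul_mem (pow_mem hui _) (sub_mem (add_mem (sub_mem (add_mem (sub_mem h₄ (mul_mem hs h₃))
      (mul_mem (mul_mem (ofNat_mem _ _) hr) h₂)) (mul_mem (add_mem ht (mul_mem hr hs)) h₁))
      (mul_mem (ofNat_mem _ _) (pow_mem hr _))) (mul_mem (mul_mem (ofNat_mem _ _) hs) ht))
  · rw [variableChange_a₆]
    exact mul_mem (pow_mem hui _) (sub_mem (sub_mem (sub_mem (add_mem (add_mem (add_mem h₆
      (mul_mem hr h₄)) (mul_mem (pow_mem hr _) h₂)) (pow_mem hr _)) (mul_mem ht h₃)) (pow_mem ht _))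
      (mul_mem (mul_mem hr ht) h₁))

/-- **`θ ∈ ℤ_p⟦z⟧`** for a `p`-integral equation and a `p`-integral change of variables
(`w(z) ∈ ℤ_p⟦z⟧`, and `den = 1 + ⋯` is a unit of `ℤ_p⟦z⟧`). [Silverman AEC IV.1, VII.2]
[folklore] -/
theorem isPadicInt_formalVariableChange [V.IsIntegral ℤ_[p]] (hu : ‖(vc.u : ℚ_[p])‖ ≤ 1)
    (hr : ‖vc.r‖ ≤ 1) (hs : ‖vc.s‖ ≤ 1) (ht : ‖vc.t‖ ≤ 1) :
    IsPadicInt (V.formalVariableChange vc) := by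
  have hw := V.isPadicInt_formalW
  have hts : ‖vc.t - vc.s * vc.r‖ ≤ 1 := by
    rw [← PadicInt.mem_subring_iff] at hr hs ht ⊢
    exact sub_mem ht (mul_mem hs hr)
  have hden : IsPadicInt (V.formalVariableChangeDenom vc) :=
    (IsPadicInt.one.add ((IsPadicInt.powerSeries_C hs).mul IsPadicInt.powerSeries_X)).add
      ((IsPadicInt.powerSeries_C hts).mul hw)
  exact ((IsPadicInt.powerSeries_C hu).mul
    (IsPadicInt.powerSeries_X.sub ((IsPadicInt.powerSeries_C hr).mul hw))).mul
    (hden.invOfUnit_one (V.constantCoeff_formalVariableChangeDenom vc))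

variable {V vc} in
/-- **Mazur–Tate sigma pairs transport along a `p`-integral change of variables.** Let `W/ℚ_p`
be a `p`-integral Weierstrass equation and `vc = (u, r, s, t)` a change of variables with
`u ∈ ℤ_pˣ`, `r, s, t ∈ ℤ_p`. If `(σ', c')` is a Mazur–Tate sigma pair of `vc • W`
(`σ' = z' + ⋯ ∈ z'ℤ_p⟦z'⟧` odd, `c' ∈ ℤ_p`, `x' + c' = -D'(D'σ'/σ')`), then
**`(u⁻¹·σ' ∘ θ, u²c' - r)` is a Mazur–Tate sigma pair of `W`** — the sigma function of
`(E, ω)` is `λ⁻¹` times that of `(E, λ⁻¹ω)` read through the isomorphism, and `c` has weight `2`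
and shifts by `-r` with `x = u²x' + r`. [Mazur–Tate 1991, §3 (functoriality of `σ_{(E,ω)}`);
Mazur–Stein–Tate 2006, Thm. 1.3 and §1 (`c = (a₁² + 4a₂)/12 - E₂(E, ω)/12`)]
[cite: MazurSteinTate2006, Thm. 1.3] -/
theorem IsMazurTateSigmaPair.of_variableChange [V.IsIntegral ℤ_[p]] (hu : ‖(vc.u : ℚ_[p])‖ = 1)
    (hr : ‖vc.r‖ ≤ 1) (hs : ‖vc.s‖ ≤ 1) (ht : ‖vc.t‖ ≤ 1) {σ' : ℚ_[p]⟦X⟧} {c' : ℚ_[p]}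
    (h : (vc • V).IsMazurTateSigmaPair σ' c') :
    V.IsMazurTateSigmaPair (C ((vc.u⁻¹ : ℚ_[p]ˣ) : ℚ_[p]) * σ'.subst (V.formalVariableChange vc))
      ((vc.u : ℚ_[p]) ^ 2 * c' - vc.r) where
  constantCoeff_eq := by
    rw [map_mul, V.constantCoeff_subst_formalVariableChange vc h.constantCoeff_eq, mul_zero]
  coeff_one_eq := by
    rw [coeff_C_mul, V.coeff_one_subst_formalVariableChange vc h.coeff_one_eq, Units.inv_mul]
  norm_coeff_le := by
    have hui : ‖((vc.u⁻¹ : ℚ_[p]ˣ) : ℚ_[p])‖ ≤ 1 := by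
      rw [Units.val_inv_eq_inv_val, norm_inv, hu, inv_one]
    have hθ := V.isPadicInt_formalVariableChange vc hu.le hr hs ht
    exact isPadicInt_iff_coeff.mp ((IsPadicInt.powerSeries_C hui).mul
      (h.isPadicInt_sigma.powerSeries_subst hθ (V.hasSubst_formalVariableChange vc)))
  norm_const_le := by
    have hc := h.norm_const_le
    rw [← PadicInt.mem_subring_iff] at hr hc ⊢
    have hu' : (vc.u : ℚ_[p]) ∈ PadicInt.subring p := by rw [PadicInt.mem_subring_iff, hu]
    exact sub_mem (mul_mem (pow_mem hu' 2) hc) hr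
  odd := h.odd.variableChange_subst _
  ode := h.ode.variableChange_subst h.constantCoeff_eq h.coeff_one_eq

variable {V vc} in
/-- Hence **existence of a Mazur–Tate sigma pair transports** from `vc • W` to `W` (and back,
with `vc⁻¹`). [Mazur–Tate 1991, §3; Mazur–Stein–Tate 2006, Thm. 1.3] [folklore] -/
theorem exists_isMazurTateSigmaPair_of_variableChange [V.IsIntegral ℤ_[p]]
    (hu : ‖(vc.u : ℚ_[p])‖ = 1) (hr : ‖vc.r‖ ≤ 1) (hs : ‖vc.s‖ ≤ 1) (ht : ‖vc.t‖ ≤ 1)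
    (hex : ∃ σ' : ℚ_[p]⟦X⟧, ∃ c', (vc • V).IsMazurTateSigmaPair σ' c') :
    ∃ σ : ℚ_[p]⟦X⟧, ∃ c, V.IsMazurTateSigmaPair σ c := by
  obtain ⟨σ', c', h⟩ := hex
  exact ⟨_, _, h.of_variableChange hu hr hs ht⟩

/-! ### The Hasse coefficient `c_{p-1}` is invariant -/

/-- **The unit-ness of the Hasse coefficient `c_{p-1}` (`ω = Σ cₙ zⁿ dz`) is invariant under
`p`-integral changes of variables with `u ∈ ℤ_pˣ`.** Comparing `z^p`-coefficients in
`log' ∘ θ = u·log` (`log = Σ c_{n-1}zⁿ/n`): `u·c_{p-1}/p = u^p·c'_{p-1}/p + Σ_{n<p} (c'_{n-1}/n)·[z^p]θⁿ`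
with the finite sum in `ℤ_p` (`n < p` is a unit, `θ ∈ ℤ_p⟦z⟧`, `[z^p]θ^p = u^p`), so
`‖u c_{p-1} - u^p c'_{p-1}‖ ≤ p⁻¹ < 1`. (For `p ≥ 3` odd, `c_{p-1} mod p` is the Hasse invariant:
Blakestad–Grant 2023, Prop. 3(b), `H₁ = w_{p-1}`.) [Blakestad–Grant 2023, Prop. 3(b) and the
Remark before it (`H₁ = w_{p-1}` lifts the Hasse invariant); Silverman AEC IV.5.5]
[cite: BlakestadGrant2023, Prop. 3] -/
theorem norm_coeff_formalOmega_variableChange_eq_one [V.IsIntegral ℤ_[p]]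
    (hu : ‖(vc.u : ℚ_[p])‖ = 1) (hr : ‖vc.r‖ ≤ 1) (hs : ‖vc.s‖ ≤ 1) (ht : ‖vc.t‖ ≤ 1)
    (hc : ‖coeff (p - 1) V.formalOmega‖ = 1) : ‖coeff (p - 1) (vc • V).formalOmega‖ = 1 := by
  haveI := V.isIntegral_variableChange vc hu hr hs ht
  have hsucc : p - 1 + 1 = p := Nat.succ_pred_eq_of_pos (Fact.out : p.Prime).pos
  have hp1 : (((p - 1 : ℕ) : ℚ_[p]) + 1) = (p : ℚ_[p]) := by exact_mod_cast hsucc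
  have hθint := V.isPadicInt_formalVariableChange vc hu.le hr hs ht
  have hlog := V.coeff_succ_formalLog (p - 1)
  have hlog' := (vc • V).coeff_succ_formalLog (p - 1)
  rw [hsucc, hp1] at hlog hlog'
  -- compare `[z^p]` in `log' ∘ θ = u log`
  have hL := congrArg (coeff p) (V.formalLog_variableChange_subst vc)
  rw [coeff_C_mul, coeff_subst_eq_sum_range (V.constantCoeff_formalVariableChange vc),
    Finset.sum_range_succ, V.coeff_self_pow_formalVariableChange vc p, hlog, hlog'] at hL
  -- the lower terms lie in `ℤ_p`
  have hS : (∑ d ∈ Finset.range p, coeff p (V.formalVariableChange vc ^ d) *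
      coeff d (vc • V).formalLog) ∈ PadicInt.subring p := by
    refine Subring.sum_mem _ fun d hd => ?_
    rw [Finset.mem_range] at hd
    refine mul_mem ?_ ?_
    · rw [PadicInt.mem_subring_iff]
      exact isPadicInt_iff_coeff.mp (hθint.pow d) p
    · rcases d with _ | d
      · rw [coeff_zero_eq_constantCoeff_apply, constantCoeff_formalLog]; exact zero_mem _
      · rw [(vc • V).coeff_succ_formalLog d]
        refine mul_mem ?_ ?_
        · rw [PadicInt.mem_subring_iff, show ((d : ℚ_[p]) + 1) = ((d + 1 : ℕ) : ℚ_[p]) by push_cast; ring,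
            norm_inv_natCast_eq_one (Nat.succ_pos d) hd]
        · rw [PadicInt.mem_subring_iff]
          exact isPadicInt_iff_coeff.mp (vc • V).isPadicInt_formalOmega d
  rw [PadicInt.mem_subring_iff] at hS
  set S := ∑ d ∈ Finset.range p, coeff p (V.formalVariableChange vc ^ d) *
      coeff d (vc • V).formalLog with hSdef
  set c := coeff (p - 1) V.formalOmega with hcdef
  set c' := coeff (p - 1) (vc • V).formalOmega with hc'def
  have hp0 : (p : ℚ_[p]) ≠ 0 := Nat.cast_ne_zero.mpr (Fact.out : p.Prime).ne_zero
  -- `u c - u^p c' = p S`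
  have hinv : (p : ℚ_[p]) * (p : ℚ_[p])⁻¹ = 1 := mul_inv_cancel₀ hp0
  have key : (vc.u : ℚ_[p]) * c - (vc.u : ℚ_[p]) ^ p * c' = p * S := by
    linear_combination (-(p : ℚ_[p])) * hL - ((vc.u : ℚ_[p]) * c - (vc.u : ℚ_[p]) ^ p * c') * hinv
  have hlt : ‖(vc.u : ℚ_[p]) * c - (vc.u : ℚ_[p]) ^ p * c'‖ < 1 := by
    rw [key, norm_mul, Padic.norm_p]
    calc (p : ℝ)⁻¹ * ‖S‖ ≤ (p : ℝ)⁻¹ * 1 := by gcongr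
      _ < 1 := by
        rw [mul_one, inv_lt_one_iff₀]
        exact Or.inr (by exact_mod_cast (Fact.out : p.Prime).one_lt)
  have huc : ‖(vc.u : ℚ_[p]) * c‖ = 1 := by rw [norm_mul, hu, one_mul]; exact hc
  have hc'le : ‖(vc.u : ℚ_[p]) ^ p * c'‖ ≤ 1 := by
    rw [norm_mul, norm_pow, hu, one_pow, one_mul]
    exact isPadicInt_iff_coeff.mp (vc • V).isPadicInt_formalOmega _
  have hc'ge : ¬ ‖(vc.u : ℚ_[p]) ^ p * c'‖ < 1 := by
    intro hlt'
    have := Padic.nonarchimedean ((vc.u : ℚ_[p]) * c - (vc.u : ℚ_[p]) ^ p * c')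
      ((vc.u : ℚ_[p]) ^ p * c')
    rw [sub_add_cancel, huc] at this
    exact absurd this (not_le.mpr (max_lt hlt hlt'))
  have h1 : ‖(vc.u : ℚ_[p]) ^ p * c'‖ = 1 := le_antisymm hc'le (not_lt.mp hc'ge)
  rwa [norm_mul, norm_pow, hu, one_pow, one_mul] at h1

/-! ### The short Weierstrass model at `p ≥ 5` -/

/-- `toShortNF` has `u = 1`. [folklore] -/
theorem toShortNF_u (V' : WeierstrassCurve ℚ_[p]) : V'.toShortNF.u = 1 := by
  rw [toShortNF, VariableChange.mul_def]
  simp [toCharNeTwoNF]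

/-- **For `p ≥ 5`, Mathlib's explicit change of variables `toShortNF` to the short model
`y² = x³ + a₄'x + a₆'` of a `p`-integral equation is `p`-integral**: `u = 1` and
`r = -b₂/12`, `s = -a₁/2`, `t = -a₃/2 + a₁b₂/24` lie in `ℤ_p` (`2, 3 ∈ ℤ_pˣ`).
[Silverman AEC III.1 (the substitutions for `char ≠ 2, 3`)] [folklore] -/
theorem norm_toShortNF_le [V.IsIntegral ℤ_[p]] (hp : 5 ≤ p) :
    ‖(V.toShortNF.u : ℚ_[p])‖ = 1 ∧ ‖V.toShortNF.r‖ ≤ 1 ∧ ‖V.toShortNF.s‖ ≤ 1 ∧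
      ‖V.toShortNF.t‖ ≤ 1 := by
  obtain ⟨h₁, h₂, h₃, -, -⟩ := V.coeffs_mem_subring
  have h2 : (⅟(2 : ℚ_[p])) ∈ PadicInt.subring p := by
    have := invOf_natCast_mem_subring (p := p) 2 (by norm_num) (by omega)
    simpa using this
  have h3 : (⅟(3 : ℚ_[p])) ∈ PadicInt.subring p := by
    have := invOf_natCast_mem_subring (p := p) 3 (by norm_num) (by omega)
    simpa using this
  -- the intermediate model `y² = x³ + a₂'x² + ⋯` is integral
  have hs₀ : ‖V.toCharNeTwoNF.s‖ ≤ 1 := by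
    rw [toCharNeTwoNF_s, ← PadicInt.mem_subring_iff]; exact mul_mem h2 (neg_mem h₁)
  have ht₀ : ‖V.toCharNeTwoNF.t‖ ≤ 1 := by
    rw [toCharNeTwoNF_t, ← PadicInt.mem_subring_iff]; exact mul_mem h2 (neg_mem h₃)
  have hu₀ : ‖(V.toCharNeTwoNF.u : ℚ_[p])‖ = 1 := by rw [toCharNeTwoNF_u, Units.val_one, norm_one]
  have hr₀ : ‖V.toCharNeTwoNF.r‖ ≤ 1 := by rw [toCharNeTwoNF_r, norm_zero]; exact zero_le_one
  haveI := V.isIntegral_variableChange V.toCharNeTwoNF hu₀ hr₀ hs₀ ht₀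
  obtain ⟨-, ha₂', -, -, -⟩ := (V.toCharNeTwoNF • V).coeffs_mem_subring
  rw [← PadicInt.mem_subring_iff] at hs₀ ht₀
  refine ⟨by rw [toShortNF_u, Units.val_one, norm_one], ?_, ?_, ?_⟩ <;>
    rw [toShortNF, VariableChange.mul_def, ← PadicInt.mem_subring_iff] <;> dsimp only
  · rw [toCharNeTwoNF_u, toCharNeTwoNF_r]
    simpa using mul_mem h3 (neg_mem ha₂')
  · rw [toCharNeTwoNF_u]
    simpa using hs₀
  · rw [toCharNeTwoNF_u]
    simpa using add_mem (mul_mem (mul_mem h3 (neg_mem ha₂')) hs₀) ht₀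

/-- The short model of a `p`-integral equation is `p`-integral for `p ≥ 5`. [Silverman AEC
III.1, VII.1] [folklore] -/
theorem isIntegral_toShortNF_smul [V.IsIntegral ℤ_[p]] (hp : 5 ≤ p) :
    (V.toShortNF • V).IsIntegral ℤ_[p] :=
  have h := V.norm_toShortNF_le hp
  V.isIntegral_variableChange V.toShortNF h.1 h.2.1 h.2.2.1 h.2.2.2

/-- The short model has the same discriminant (`u = 1`). [Silverman AEC III.1, Table 3.1
(`u¹²Δ' = Δ`)] [folklore] -/
theorem toShortNF_smul_Δ (V' : WeierstrassCurve ℚ_[p]) : (V'.toShortNF • V').Δ = V'.Δ := by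
  rw [variableChange_Δ, toShortNF_u, inv_one, Units.val_one, one_pow, one_mul]

end Padic


/-! ### The named fact reduced to existence for the short model -/

section Glue

open IsDedekindDomain NumberField Rat.HeightOneSpectrum

/-- **Good reduction at `p` of a globally minimal equation means `‖Δ_W‖_p = 1`** (`W ⊗ ℚ_p` is a
minimal equation at `p`, AEC VII.1.3(b), VII.5.1(a)). A local copy of the (private) argument of
`PadicSigmaUniquenessOrdinaryProofs.lean` / of the tree's
`not_dvd_minimalDiscriminantInt_of_hasGoodReductionAtPrime` (which lives behind the Gross–Zagier
import closure). [Silverman AEC VII.1.3(b), VII.5.1(a)] [cite: SilvermanAEC2009, VII.5.1] -/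
theorem norm_Δ_baseChange_eq_one_of_hasGoodReductionAtPrime (W : WeierstrassCurve ℚ)
    [W.IsGloballyMinimal] (p : ℕ) [Fact p.Prime] (h : W.HasGoodReductionAtPrime p) :
    ‖(W.baseChange ℚ_[p]).Δ‖ = 1 := by
  -- `¬ p ∣ Δ_min`
  have hndvd : ¬ (p : ℤ) ∣ minimalDiscriminantInt W := by
    obtain ⟨v, hv⟩ : ∃ v : HeightOneSpectrum (𝓞 ℚ), (primesEquiv v : ℕ) = p :=
      ⟨primesEquiv.symm ⟨p, Fact.out⟩, by rw [Equiv.apply_symm_apply]⟩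
    subst hv
    have he := padicEquiv_mem_range_iff_ringOfIntegers v
    have hW : (W.baseChange (v.adicCompletion ℚ)).map
        ((adicCompletion.padicEquiv v).toAlgEquiv.toRingEquiv :
          v.adicCompletion ℚ →+* ℚ_[(primesEquiv v : ℕ)]) = W.baseChange ℚ_[(primesEquiv v : ℕ)] := by
      simp only [baseChange, map_map]
      exact congrArg W.map (Subsingleton.elim _ _)
    haveI hmin : (W.baseChange ℚ_[(primesEquiv v : ℕ)]).IsMinimal ℤ_[(primesEquiv v : ℕ)] := by
      rw [← hW]
      exact (isMinimal_map_iff _ he _).mpr (IsGloballyMinimal.isMinimal v)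
    obtain ⟨D, hD⟩ : ∃ D : VariableChange ℚ_[(primesEquiv v : ℕ)],
        (W.baseChange ℚ_[(primesEquiv v : ℕ)]).minimal ℤ_[(primesEquiv v : ℕ)] =
          D • W.baseChange ℚ_[(primesEquiv v : ℕ)] := ⟨_, rfl⟩
    have hgood : (W.baseChange ℚ_[(primesEquiv v : ℕ)]).HasGoodReduction ℤ_[(primesEquiv v : ℕ)] :=
      (hasGoodReduction_iff_of_isMinimal_of_eq_smul ℤ_[(primesEquiv v : ℕ)] hD).mp h
    set Mp : WeierstrassCurve ℤ_[(primesEquiv v : ℕ)] :=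
      (integralModelInt W).map (Int.castRingHom ℤ_[(primesEquiv v : ℕ)]) with hMp
    have hWM : W.baseChange ℚ_[(primesEquiv v : ℕ)] = Mp.baseChange ℚ_[(primesEquiv v : ℕ)] := by
      conv_lhs => rw [← map_integralModelInt W]
      rw [baseChange, baseChange, map_map, hMp, map_map]
      congr 1
    have hΔ := hgood.goodReduction
    rw [hWM, baseChange, map_Δ, IsDedekindDomain.HeightOneSpectrum.valuation_eq_one_iff_notMem] at hΔ
    change Mp.Δ ∉ IsLocalRing.maximalIdeal ℤ_[(primesEquiv v : ℕ)] at hΔ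
    rw [hMp, map_Δ, IsLocalRing.mem_maximalIdeal, PadicInt.mem_nonunits, eq_intCast,
      PadicInt.norm_int_lt_one_iff_dvd] at hΔ
    exact hΔ
  have hΔ : (W.baseChange ℚ_[p]).Δ = ((minimalDiscriminantInt W : ℤ) : ℚ_[p]) := by
    rw [baseChange, map_Δ, ← cast_minimalDiscriminantInt W, eq_ratCast, Rat.cast_intCast]
  rw [hΔ]
  exact le_antisymm (Padic.norm_int_le_one _) (not_lt.mp (mt Padic.norm_intCast_lt_one_iff.mp hndvd))

/-- **`mazur_tate_sigma_existsUnique` (Mazur–Stein–Tate 2006, Thm. 1.3) reduced to the EXISTENCE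
of a Mazur–Tate sigma pair for SHORT Weierstrass models.** Suppose that for every prime `p ≥ 5`
and every `p`-integral short Weierstrass equation `V : y² = x³ + a₄x + a₆` over `ℚ_p` with unit
discriminant (`‖Δ‖_p = 1`, good reduction) and unit Hasse coefficient (`‖c_{p-1}‖_p = 1`,
`ω = Σ cₙ zⁿ dz`, i.e. ORDINARY reduction — Blakestad–Grant's `H₁ = w_{p-1} ≡ H (mod p)`) there is
a Mazur–Tate sigma pair (`σ ∈ zℤ_p⟦z⟧` odd, `c ∈ ℤ_p`, `x + c = -D(Dσ/σ)`: Mazur–Tate 1991 §3 /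
Blakestad–Grant 2023 Thms. 1, 15, the deep half, NOT proved here). Then the tree's named fact
holds: for `W/ℚ` globally minimal and `p ≥ 5` good ordinary, `W ⊗ ℚ_p` is carried by the
`p`-integral change `toShortNF` (`u = 1`) to such a `V`; a pair of `V` transports back
(`exists_isMazurTateSigmaPair_of_variableChange`), and uniqueness is the tree's
`mazur_tate_sigma_existsUnique_of_exists`. [Mazur–Stein–Tate 2006, Thm. 1.3; Mazur–Tate 1991,
Thm. 3.1; Blakestad–Grant 2023, Thm. 1 and Thm. 15] [cite: MazurSteinTate2006, Thm. 1.3] -/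
theorem mazur_tate_sigma_existsUnique_of_exists_shortModel
    (hex : ∀ (p : ℕ) [Fact p.Prime] (V : WeierstrassCurve ℚ_[p]) [V.IsIntegral ℤ_[p]] [V.IsShortNF],
      5 ≤ p → ‖V.Δ‖ = 1 → ‖coeff (p - 1) V.formalOmega‖ = 1 →
        ∃ σ : ℚ_[p]⟦X⟧, ∃ c, V.IsMazurTateSigmaPair σ c) :
    mazur_tate_sigma_existsUnique := by
  refine mazur_tate_sigma_existsUnique_of_exists fun W _ _ p _ hp hgood hord => ?_
  have hn := (W.baseChange ℚ_[p]).norm_toShortNF_le hp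
  haveI := (W.baseChange ℚ_[p]).isIntegral_toShortNF_smul hp
  have hΔ : ‖((W.baseChange ℚ_[p]).toShortNF • W.baseChange ℚ_[p]).Δ‖ = 1 := by
    rw [toShortNF_smul_Δ]
    exact norm_Δ_baseChange_eq_one_of_hasGoodReductionAtPrime W p hgood
  have hc : ‖coeff (p - 1) (W.baseChange ℚ_[p]).formalOmega‖ = 1 := by
    have h := norm_coeff_formalOmega_eq_one_of_good_ordinary W p (by omega) hgood hord 0
    rwa [zero_add, pow_one] at h
  have hc' := (W.baseChange ℚ_[p]).norm_coeff_formalOmega_variableChange_eq_one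
    (W.baseChange ℚ_[p]).toShortNF hn.1 hn.2.1 hn.2.2.1 hn.2.2.2 hc
  exact exists_isMazurTateSigmaPair_of_variableChange hn.1 hn.2.1 hn.2.2.1 hn.2.2.2
    (hex p _ hp hΔ hc')

end Glue

end WeierstrassCurve
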